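import Summits.Ventures.PercRepro.GenQEmptyClassTen
import Summits.Ventures.PercRepro.GenQFlatLatticeE

/-!
# PercRepro — the last class of corank `11`: five `15`-traces and no `14`-trace force `h₁₆ = 0` (night-4, gen 14)

The two-level profile LP at `q = 7`, type `6`, corank `11` (`n = 18`) on the tree rows is positive on every class of
the integer split `(h₁₆, h₁₅)` except `(h₁₆ ≤ 1, h₁₅ = 5, h₁₄ = 0)` (`−4,494.61`, sheet §66 (h)).  That class is negative
only through its `h₁₆ = 1` half: with `h₁₆ = 0` the exact bound is `+73,482.61` (kit j269513).  This file (part A) and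
`GenQClassElevenSixteenB` (part B) prove that the half is empty: **`hypTr_sixteen_eq_zero_of_five_zero`** (part B) — on an
`18`-point rank-`7` set of the core with five `15`-point hyperplane traces and no `14`-point one there is no `16`-point
hyperplane trace.  Part A: the flat bridges and the two impossible intersection sizes.

The argument.  Two distinct `15`-traces meet `G` in `f ≥ 12` points and their intersection `F` is a rank-`5` flat
(`inter_mem_flatsQ_of_large_traces`).  `f = 14` is impossible (`card_inter_ne_fourteen`): every `15`-trace then contains
`F` (`≥ 11 > 10` common points, `subset_of_eleven_le_card_inter`) and is determined by its single point outside `F`, so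
`h₁₅ ≤ |G ∖ F| = 4`.  `f = 13` is impossible (`card_inter_ne_thirteen`): the point `y` of `G` outside both traces gives the
hyperplane `cl(F ∪ y)`, whose trace is exactly `F ∩ G ∪ {y}` — a point of a `15`-trace outside `F` would pull that trace
into `cl(F ∪ y)` — a `14`-trace.  So `f = 12` (`card_inter_eq_twelve`): the five complements `G ∖ Hᵢ` are pairwise
disjoint `3`-sets.  A `16`-trace `K` misses two points `u, v` of `G`; `u` lies in at most one complement, so three of the
`15`-traces contain `u`; their intersection `S` is a flat of rank `≤ 4` (a rank-`5` flat `H₁ ∩ H₂` is not inside `H₃`, which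
misses a point of it) with `≥ 9` points of `G`; `S ⊄ K` (`u ∈ S ∖ K`), so `K ∩ S` is a flat of rank `≤ 3` with `≥ 9 − 2 = 7`
points — more than a flat of rank `≤ 3` of the core can hold (`flats_le_three_card_le_six`).
Imports `GenQEmptyClassTen` (the flat bridges) and `GenQFlatLatticeE` (`clF_mem_flatsTr`).
-/
namespace PercRepro.Night4

open Finset ThmH SixFour GenQ PerFlat Star

variable {α : Type*} [DecidableEq α] {M : Matroid α} [M.Finite]

/-- Two flats with the same spanning trace on `G` coincide. -/
theorem eq_of_inter_eq_of_mem_flatsTr {G H H' : Finset α} {r s s' : ℕ} (hH : H ∈ flatsTr M G r s)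
    (hH' : H' ∈ flatsTr M G r s') (h : H ∩ G = H' ∩ G) : H = H' := by
  have h1 := mem_flatsTr.1 hH
  have h1' := mem_flatsTr.1 hH'
  have hsub : H ⊆ H' := subset_of_subset_of_eRk_eq h1.1 (mem_flatsQ.1 h1'.1).2.1 Finset.inter_subset_left
    (by rw [h]; exact Finset.inter_subset_left) h1.2.2
  have hsub' : H' ⊆ H := subset_of_subset_of_eRk_eq h1'.1 (mem_flatsQ.1 h1.1).2.1 Finset.inter_subset_left
    (by rw [← h]; exact Finset.inter_subset_left) h1'.2.2
  exact Finset.Subset.antisymm hsub hsub'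

/-- The intersection of a member of `flatsQ` with a flat is a member of `flatsQ` of some rank `≤` the first. -/
theorem exists_inter_mem_flatsQ_le {a : ℕ} {F K : Finset α} (hF : F ∈ flatsQ M a) (hK : M.IsFlat (K : Set α)) :
    ∃ b, F ∩ K ∈ flatsQ M b ∧ b ≤ a := by
  obtain ⟨b, hb⟩ := exists_eRk_eq_nat' (M := M) (F ∩ K)
  have hF1 := mem_flatsQ.1 hF
  refine ⟨b, mem_flatsQ.2 ⟨Finset.inter_subset_left.trans hF1.1, ?_, hb⟩, ?_⟩
  · rw [Finset.coe_inter]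
    exact isFlat_inter_of_isFlat' hF1.2.1 hK
  · have hle : (b : ℕ∞) ≤ (a : ℕ∞) := by
      rw [← hb, ← hF1.2.2]
      exact M.eRk_mono (Finset.coe_subset.2 Finset.inter_subset_left)
    exact_mod_cast hle

/-- If a member `F` of `flatsQ` is not inside the flat `K`, then `F ∩ K` has rank `< rank F`. -/
theorem exists_inter_mem_flatsQ_lt_of_not_subset {a : ℕ} {F K : Finset α} (hF : F ∈ flatsQ M a)
    (hK : M.IsFlat (K : Set α)) (hnot : ¬ F ⊆ K) : ∃ b, F ∩ K ∈ flatsQ M b ∧ b < a := by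
  obtain ⟨b, hFK, hba⟩ := exists_inter_mem_flatsQ_le hF hK
  refine ⟨b, hFK, lt_of_le_of_ne hba ?_⟩
  intro hba'
  rw [hba'] at hFK
  have := eq_of_subset_of_mem_flatsQ hFK hF Finset.inter_subset_left
  exact hnot (by rw [← this]; exact Finset.inter_subset_right)

/-- A rank-`5` flat meeting a flat in `≥ 11` points of the core lies inside it (flats of rank `≤ 4` have `≤ 10` points). -/
theorem subset_of_eleven_le_card_inter (hB : ∀ a ≤ 7 - 3, ∀ K ∈ flatsQ M a, K.card ≤ 10) {F K : Finset α}
    (hF : F ∈ flatsQ M 5) (hK : M.IsFlat (K : Set α)) (h11 : 11 ≤ (F ∩ K).card) : F ⊆ K := by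
  by_contra hnot
  obtain ⟨b, hFK, hb⟩ := exists_inter_mem_flatsQ_lt_of_not_subset hF hK hnot
  have := hB b (by omega) _ hFK
  omega

/-- The trace of `H ∩ H'` on `G` is the intersection of the two traces. -/
theorem inter_inter_eq {G H H' : Finset α} : (H ∩ H') ∩ G = (H ∩ G) ∩ (H' ∩ G) := by
  ext x
  simp only [Finset.mem_inter]
  tauto

/-- The two `15`-traces are not `G` minus a common point: `|(H₁ ∩ H₂) ∩ G| ≤ 14` for distinct `15`-traces. -/
theorem card_inter_le_fourteen {G H₁ H₂ : Finset α} (hH₁ : H₁ ∈ flatsTr M G 6 15)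
    (hH₂ : H₂ ∈ flatsTr M G 6 15) (hne : H₁ ≠ H₂) : ((H₁ ∩ H₂) ∩ G).card ≤ 14 := by
  have h1 := mem_flatsTr.1 hH₁
  have h2 := mem_flatsTr.1 hH₂
  by_contra hlt
  rw [not_le] at hlt
  have hsub : (H₁ ∩ H₂) ∩ G ⊆ H₁ ∩ G := by
    intro x hx
    simp only [Finset.mem_inter] at hx ⊢
    exact ⟨hx.1.1, hx.2⟩
  have hsub' : (H₁ ∩ H₂) ∩ G ⊆ H₂ ∩ G := by
    intro x hx
    simp only [Finset.mem_inter] at hx ⊢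
    exact ⟨hx.1.2, hx.2⟩
  have hle := Finset.card_le_card hsub
  have heq : (H₁ ∩ H₂) ∩ G = H₁ ∩ G := Finset.eq_of_subset_of_card_le hsub (by omega)
  have heq' : (H₁ ∩ H₂) ∩ G = H₂ ∩ G := Finset.eq_of_subset_of_card_le hsub' (by omega)
  exact hne (eq_of_inter_eq_of_mem_flatsTr hH₁ hH₂ (heq.symm.trans heq'))


/-- `|(H₁ ∩ H₂) ∩ G| ≠ 14` for distinct `15`-traces when `h₁₅ = 5` (`n = 18`): every `15`-trace would contain the
rank-`5` flat `H₁ ∩ H₂` and be determined by its single point outside it, so `h₁₅ ≤ 4`. -/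
theorem card_inter_ne_fourteen (hs : Simple M) (hline : ∀ L ∈ flatsQ M 2, L.card ≤ 3)
    (hplane : ∀ P ∈ flatsQ M 3, P.card ≤ 6) (hsolid : ∀ F ∈ flatsQ M 4, F.card ≤ 10) {G : Finset α}
    (hcard : G.card = 18) (h15 : hypTr M G 6 15 = 5) {H₁ H₂ : Finset α} (hH₁ : H₁ ∈ flatsTr M G 6 15)
    (hH₂ : H₂ ∈ flatsTr M G 6 15) (hne : H₁ ≠ H₂) : ((H₁ ∩ H₂) ∩ G).card ≠ 14 := by
  intro h14
  have hB := flats_le_four_card_le_ten hs hline hplane hsolid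
  have hF : H₁ ∩ H₂ ∈ flatsQ M 5 :=
    inter_mem_flatsQ_of_large_traces (q := 7) (s := 15) (B := 10) (by norm_num) hB hH₁ hH₂ hne (by omega)
  -- every `15`-trace contains `F = H₁ ∩ H₂`
  have hall : ∀ H ∈ flatsTr M G 6 15, H₁ ∩ H₂ ⊆ H := by
    intro H hH
    have hH' := mem_flatsTr.1 hH
    refine subset_of_eleven_le_card_inter hB hF (mem_flatsQ.1 hH'.1).2.1 ?_
    have hsub : ((H₁ ∩ H₂) ∩ G) ∩ (H ∩ G) ⊆ (H₁ ∩ H₂) ∩ H := by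
      intro x hx
      simp only [Finset.mem_inter] at hx ⊢
      exact ⟨hx.1.1, hx.2.1⟩
    have hU : ((H₁ ∩ H₂) ∩ G) ∪ (H ∩ G) ⊆ G := by
      intro x hx
      simp only [Finset.mem_union, Finset.mem_inter] at hx
      rcases hx with hx | hx
      · exact hx.2
      · exact hx.2
    have h1 := Finset.card_union_add_card_inter ((H₁ ∩ H₂) ∩ G) (H ∩ G)
    have h2 := Finset.card_le_card hU
    have h3 := Finset.card_le_card hsub
    rw [hH'.2.1, h14] at h1
    omega
  -- the outside set `O = G ∖ F` has `4` points; `H ↦ (H ∩ G) ∖ F` is injective into its `1`-subsets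
  have hO : (G \ (H₁ ∩ H₂)).card = 4 := by
    rw [Finset.card_sdiff, hcard, h14]
  have hmaps : Set.MapsTo (fun H : Finset α => (H ∩ G) \ (H₁ ∩ H₂)) (flatsTr M G 6 15 : Set (Finset α))
      ((G \ (H₁ ∩ H₂)).powersetCard 1 : Set (Finset α)) := by
    intro H hH
    rw [Finset.mem_coe] at hH ⊢
    have hH' := mem_flatsTr.1 hH
    rw [Finset.mem_powersetCard]
    refine ⟨?_, ?_⟩
    · intro x hx
      rw [Finset.mem_sdiff, Finset.mem_inter] at hx
      rw [Finset.mem_sdiff]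
      exact ⟨hx.1.2, hx.2⟩
    · have hFsub : (H₁ ∩ H₂) ∩ (H ∩ G) = (H₁ ∩ H₂) ∩ G := by
        ext x
        constructor
        · intro hx
          rw [Finset.mem_inter] at hx ⊢
          exact ⟨hx.1, (Finset.mem_inter.1 hx.2).2⟩
        · intro hx
          rw [Finset.mem_inter] at hx ⊢
          exact ⟨hx.1, Finset.mem_inter.2 ⟨hall H hH hx.1, hx.2⟩⟩
      rw [Finset.card_sdiff, hFsub, hH'.2.1, h14]
  have hinj : Set.InjOn (fun H : Finset α => (H ∩ G) \ (H₁ ∩ H₂)) (flatsTr M G 6 15 : Set (Finset α)) := by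
    intro H hH H' hH' heq
    rw [Finset.mem_coe] at hH hH'
    simp only at heq
    have hdecomp : ∀ K ∈ flatsTr M G 6 15, K ∩ G = ((H₁ ∩ H₂) ∩ G) ∪ ((K ∩ G) \ (H₁ ∩ H₂)) := by
      intro K hK
      ext x
      rw [Finset.mem_union, Finset.mem_sdiff]
      constructor
      · intro hx
        by_cases hxF : x ∈ H₁ ∩ H₂
        · exact Or.inl (Finset.mem_inter.2 ⟨hxF, (Finset.mem_inter.1 hx).2⟩)
        · exact Or.inr ⟨hx, hxF⟩
      · rintro (hx | hx)
        · rw [Finset.mem_inter] at hx ⊢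
          exact ⟨hall K hK hx.1, hx.2⟩
        · exact hx.1
    exact eq_of_inter_eq_of_mem_flatsTr hH hH' (by rw [hdecomp H hH, hdecomp H' hH', heq])
  have hle := Finset.card_le_card_of_injOn _ hmaps hinj
  rw [Finset.card_powersetCard, hO] at hle
  unfold hypTr at h15
  rw [h15] at hle
  norm_num at hle

/-- `|(H₁ ∩ H₂) ∩ G| ≠ 13` for distinct `15`-traces when `h₁₄ = 0` (`n = 18`): the point `y` of `G` outside both
traces spans with `F = H₁ ∩ H₂` a hyperplane whose trace is exactly `(F ∩ G) ∪ {y}`, a `14`-trace. -/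
theorem card_inter_ne_thirteen (hs : Simple M) (hline : ∀ L ∈ flatsQ M 2, L.card ≤ 3)
    (hplane : ∀ P ∈ flatsQ M 3, P.card ≤ 6) (hsolid : ∀ F ∈ flatsQ M 4, F.card ≤ 10) {G : Finset α}
    (hG : G ⊆ gr M) (hcard : G.card = 18) (h14 : hypTr M G 6 14 = 0) {H₁ H₂ : Finset α}
    (hH₁ : H₁ ∈ flatsTr M G 6 15) (hH₂ : H₂ ∈ flatsTr M G 6 15) (hne : H₁ ≠ H₂) :
    ((H₁ ∩ H₂) ∩ G).card ≠ 13 := by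
  intro h13
  have hB := flats_le_four_card_le_ten hs hline hplane hsolid
  have hF : H₁ ∩ H₂ ∈ flatsQ M 5 :=
    inter_mem_flatsQ_of_large_traces (q := 7) (s := 15) (B := 10) (by norm_num) hB hH₁ hH₂ hne (by omega)
  have hF' := mem_flatsQ.1 hF
  have h1 := mem_flatsTr.1 hH₁
  have h2 := mem_flatsTr.1 hH₂
  -- the point `y` outside both traces
  have hU : (H₁ ∩ G) ∪ (H₂ ∩ G) ⊆ G := by
    intro x hx
    simp only [Finset.mem_union, Finset.mem_inter] at hx
    rcases hx with hx | hx
    · exact hx.2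
    · exact hx.2
  have hUcard : ((H₁ ∩ G) ∪ (H₂ ∩ G)).card = 17 := by
    have := Finset.card_union_add_card_inter (H₁ ∩ G) (H₂ ∩ G)
    rw [← inter_inter_eq, h13, h1.2.1, h2.2.1] at this
    omega
  obtain ⟨y, hyG, hyU⟩ := Finset.exists_mem_notMem_of_card_lt_card (by rw [hUcard, hcard]; norm_num : ((H₁ ∩ G) ∪ (H₂ ∩ G)).card < G.card)
  have hyH₁ : y ∉ H₁ := fun h => hyU (Finset.mem_union.2 (Or.inl (Finset.mem_inter.2 ⟨h, hyG⟩)))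
  have hyH₂ : y ∉ H₂ := fun h => hyU (Finset.mem_union.2 (Or.inr (Finset.mem_inter.2 ⟨h, hyG⟩)))
  have hyF : y ∉ H₁ ∩ H₂ := fun h => hyH₁ (Finset.mem_inter.1 h).1
  -- `F ∩ G` spans `F`
  have hrFG : M.eRk (((H₁ ∩ H₂) ∩ G : Finset α) : Set α) = ((7 - 2 : ℕ) : ℕ∞) :=
    eRk_eq_of_subset_flat_of_flats_le (q := 7) (B := 10) (by norm_num) hB hG hF (Finset.Subset.refl _) (by omega)
  have hclFG : M.closure (((H₁ ∩ H₂) ∩ G : Finset α) : Set α) = ((H₁ ∩ H₂ : Finset α) : Set α) := by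
    have := (M.isRkFinite_of_finite (Finset.finite_toSet ((H₁ ∩ H₂) ∩ G))).closure_eq_closure_of_subset_of_eRk_ge_eRk
      (Finset.coe_subset.2 (Finset.inter_subset_left : (H₁ ∩ H₂) ∩ G ⊆ H₁ ∩ H₂)) (by rw [hrFG, hF'.2.2])
    rw [this, hF'.2.1.closure]
  -- `X = (F ∩ G) ∪ {y}` has rank `6`
  set X : Finset α := insert y ((H₁ ∩ H₂) ∩ G) with hXdef
  have hXG : X ⊆ G := by
    intro x hx
    rw [hXdef, Finset.mem_insert] at hx
    rcases hx with hx | hx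
    · rw [hx]; exact hyG
    · exact (Finset.mem_inter.1 hx).2
  have hyE : y ∈ M.E := by
    rw [← coe_gr M]
    exact Finset.mem_coe.2 (hG hyG)
  have hrX : M.eRk (X : Set α) = ((6 : ℕ) : ℕ∞) := by
    rw [hXdef, Finset.coe_insert, Matroid.eRk_insert_eq_add_one, hrFG]
    · norm_num
    · rw [Set.mem_sdiff, hclFG]
      exact ⟨hyE, fun h => hyF (Finset.mem_coe.1 h)⟩
  have hXcard : X.card = 14 := by
    rw [hXdef, Finset.card_insert_of_notMem, h13]
    intro h
    exact hyF (Finset.mem_inter.1 h).1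
  -- the hyperplane `K = cl X` has trace exactly `X`
  have hK := clF_mem_flatsTr hG hXG hrX
  have hXK : X ⊆ clF M X ∩ G := by
    intro x hx
    refine Finset.mem_inter.2 ⟨?_, hXG hx⟩
    rw [← Finset.mem_coe, coe_clF]
    exact M.subset_closure _ (by rw [← coe_gr M]; exact Finset.coe_subset.2 (hXG.trans hG)) (Finset.mem_coe.2 hx)
  have hFK : H₁ ∩ H₂ ⊆ clF M X := by
    intro x hx
    rw [← Finset.mem_coe, coe_clF]
    have hsub : M.closure (((H₁ ∩ H₂) ∩ G : Finset α) : Set α) ⊆ M.closure (X : Set α) :=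
      M.closure_subset_closure (Finset.coe_subset.2 (by rw [hXdef]; exact Finset.subset_insert _ _))
    exact hsub (by rw [hclFG]; exact Finset.mem_coe.2 hx)
  have hKX : clF M X ∩ G ⊆ X := by
    intro z hz
    rw [Finset.mem_inter] at hz
    by_cases hzF : z ∈ H₁ ∩ H₂
    · rw [hXdef]; exact Finset.mem_insert_of_mem (Finset.mem_inter.2 ⟨hzF, hz.2⟩)
    -- `z ∉ F`: `z = y` or `z` lies in one of the two traces and drags it into `K`
    have hzE : z ∈ M.E := by
      rw [← coe_gr M]
      exact Finset.mem_coe.2 (hG hz.2)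
    have hpull : ∀ H ∈ flatsTr M G 6 15, H₁ ∩ H₂ ⊆ H → z ∈ H → H = clF M X := by
      intro H hH hFH hzH
      have hH' := mem_flatsTr.1 hH
      have hrz : M.eRk ((insert z (H₁ ∩ H₂) : Finset α) : Set α) = ((6 : ℕ) : ℕ∞) := by
        rw [Finset.coe_insert, Matroid.eRk_insert_eq_add_one, hF'.2.2]
        · norm_num
        · rw [Set.mem_sdiff, hF'.2.1.closure]
          exact ⟨hzE, fun h => hzF (Finset.mem_coe.1 h)⟩
      have hsub : H ⊆ clF M X :=
        subset_of_subset_of_eRk_eq hH'.1 (mem_flatsQ.1 (mem_flatsTr.1 hK).1).2.1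
          (Finset.insert_subset hzH hFH) (Finset.insert_subset hz.1 hFK) hrz
      exact eq_of_subset_of_mem_flatsQ hH'.1 (mem_flatsTr.1 hK).1 hsub
    by_cases hzH₁ : z ∈ H₁
    · exfalso
      have := hpull H₁ hH₁ Finset.inter_subset_left hzH₁
      exact hyH₁ (by rw [this]; exact (Finset.mem_inter.1 (hXK (Finset.mem_insert_self _ _))).1)
    by_cases hzH₂ : z ∈ H₂
    · exfalso
      have := hpull H₂ hH₂ Finset.inter_subset_right hzH₂
      exact hyH₂ (by rw [this]; exact (Finset.mem_inter.1 (hXK (Finset.mem_insert_self _ _))).1)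
    -- `z ∉ H₁ ∪ H₂`, so `z = y` (the union has `17` points)
    have hzy : z = y := by
      by_contra hzy
      have hsub : insert z ((H₁ ∩ G) ∪ (H₂ ∩ G)) ⊆ G := by
        intro x hx
        rw [Finset.mem_insert] at hx
        rcases hx with hx | hx
        · rw [hx]; exact hz.2
        · exact hU hx
      have hcard' : (insert z ((H₁ ∩ G) ∪ (H₂ ∩ G))).card = 18 := by
        rw [Finset.card_insert_of_notMem, hUcard]
        intro h
        rw [Finset.mem_union, Finset.mem_inter, Finset.mem_inter] at h
        rcases h with h | h
        · exact hzH₁ h.1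
        · exact hzH₂ h.1
      have heq : insert z ((H₁ ∩ G) ∪ (H₂ ∩ G)) = G := Finset.eq_of_subset_of_card_le hsub (by omega)
      have hy' : y ∈ insert z ((H₁ ∩ G) ∪ (H₂ ∩ G)) := by rw [heq]; exact hyG
      rw [Finset.mem_insert] at hy'
      rcases hy' with hy' | hy'
      · exact hzy hy'.symm
      · exact hyU hy'
    rw [hzy, hXdef]
    exact Finset.mem_insert_self _ _
  have hKG : clF M X ∩ G = X := Finset.Subset.antisymm hKX hXK
  rw [hKG, hXcard] at hK
  unfold hypTr at h14
  rw [Finset.card_eq_zero] at h14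
  rw [h14] at hK
  exact Finset.notMem_empty _ hK

end PercRepro.Night4
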